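import Mathlib
import Summits.Ventures.PercRepro2.HCov
import Summits.Ventures.PercRepro2.EdgeCubic
import Summits.Ventures.PercRepro2.EdgeCubicAll
import Summits.Ventures.PercRepro2.CPolarA3
import Summits.Ventures.PercRepro2.CPolarA3Marks
import Summits.Ventures.PercRepro2.PendantClusterPins
import Summits.Ventures.PercRepro2.PendantClusterBern
import Summits.Ventures.PercRepro2.CPolarA3Exists
import Summits.Ventures.PercRepro2.ClusterRootBern
import Summits.Ventures.PercRepro2.EdgeReloc
import Summits.Ventures.PercRepro2.ReachRootEdge
import Summits.Ventures.PercRepro2.CPolarSub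
import Summits.Ventures.PercRepro2.CPolarSubClasses
import Summits.Ventures.PercRepro2.CPolarSubPlus
import Summits.Ventures.PercRepro2.HCovPlusDiag

/-!
# THE PENDANT FACE CLOSED BY (HCOV⁺): the crux from `HCovPlus_all` and (SUB) at the NON-pendant
instances (blind cell PercRepro2, p5 g16; `proofs/P5-OEDGE.md` §22)

A pendant `a₃`-cluster — a mark-free reach of `a₃` with a single fractional boundary edge
`f = {z, u}` — is taken care of by (HCOV⁺) at the identified instance `(o, a₁, a₂, u, b)`
(`CPolarSubPlus.sub_of_pendant_of_hcovPlus`), which `HCovPlus_all` supplies when `u` is unmarked,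
the diagonal theorems supply when `u = o` or `u = b` (HCovPlusDiag.lean), and which is not needed
when `u` is a root (a reach-root edge). The two degenerate cases are settled directly: a null `Q`
makes `Gc` vanish (**`Gc_eq_zero_of_Q_eq_zero`**, so (HCOV) is trivial), and `P(PD_u) = 0` with
`Q` non-null puts `u` into a root's reach (**`mem_reach_of_prob_PD_eq_zero`** — the pinned
configuration has positive weight and lies in `Q`). Hence **`goodEdgeSub_of_pendant`** and the
induction **`HCov_of_hcovPlus_all_of_subNP`**: with `HCovPlus_all`, (HCOV) follows from (SUB) at one
literal-or-not `a₃`-edge of every mark-free instance whose `a₃`-cluster is NOT pendant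
(**`HCov_all_of_cpolarA3SubNP_all`**). The open hypothesis of the road reads
«`HCovPlus_all`, and `CPolarA3SubNP_all`».
-/

namespace Summit.Ventures.PercRepro2

open UnionCluster CovForm CovForm.CPolarA3 PendantA3 PendantCluster CPolarA3Exists ClusterRoot
  ReachRoot EdgeReloc CPolarSub CPolarSubClasses CPolarSubPlus HCovPlusDiag

namespace CPolarSubNP

open EdgeLine

/-! ## A null `Q` -/

section QNull

variable {V : Type*} {E : Type*} [Fintype E] [DecidableEq E] {R : Type*} [Field R]
  [LinearOrder R] [IsStrictOrderedRing R]

variable {p : E → R} {ends : E → Sym2 V}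

/-- Every sub-event of `Q` is null when `Q` is. -/
lemma prob_eq_zero_of_subset_Q (hp : IsProbVec p) {a₁ a₂ : V}
    (hQ : prob p (avoidAll ends a₂ {a₁}) = 0) {S : Set (Config E)}
    (hS : S ⊆ avoidAll ends a₂ {a₁}) : prob p S = 0 :=
  le_antisymm (hQ ▸ prob_mono hp hS) (prob_nonneg hp S)

omit [Fintype E] [DecidableEq E] [LinearOrder R] [IsStrictOrderedRing R] in
/-- `PD ⊆ Q`. -/
lemma PD_subset_Q (a₁ a₂ a₃ : V) : PDEvent ends a₁ a₂ a₃ ⊆ avoidAll ends a₂ {a₁} := by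
  intro ω hω
  simp only [mem_avoidAll, Finset.mem_singleton, forall_eq]
  exact fun h => hω.1 (conn_symm h)

omit [Fintype E] [DecidableEq E] [LinearOrder R] [IsStrictOrderedRing R] in
/-- `T ⊆ Q`. -/
lemma T_subset_Q (a₁ a₂ a₃ : V) : TEvent ends a₁ a₂ a₃ ⊆ avoidAll ends a₂ {a₁} := by
  intro ω hω
  simp only [mem_avoidAll, Finset.mem_singleton, forall_eq]
  exact hω.1

omit [Fintype E] [DecidableEq E] [LinearOrder R] [IsStrictOrderedRing R] in
/-- `T′ ⊆ Q`. -/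
lemma T'_subset_Q (a₁ a₂ a₃ : V) : TEvent ends a₂ a₁ a₃ ⊆ avoidAll ends a₂ {a₁} := by
  intro ω hω
  simp only [mem_avoidAll, Finset.mem_singleton, forall_eq]
  exact fun h => hω.1 (conn_symm h)

/-- **`Gc` vanishes when `Q` is null** (every pattern mass is a sub-event of `Q`). -/
theorem Gc_eq_zero_of_Q_eq_zero (hp : IsProbVec p) {o a₁ a₂ a₃ b : V}
    (hQ : prob p (avoidAll ends a₂ {a₁}) = 0) : Gc p ends o a₁ a₂ a₃ b = 0 := by
  have hQi : ∀ X : Set (Config E), prob p (avoidAll ends a₂ {a₁} ∩ X) = 0 := fun X =>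
    prob_eq_zero_of_subset_Q hp hQ Set.inter_subset_left
  have hPDi : ∀ X : Set (Config E), prob p (PDEvent ends a₁ a₂ a₃ ∩ X) = 0 := fun X =>
    prob_eq_zero_of_subset_Q hp hQ (Set.inter_subset_left.trans (PD_subset_Q a₁ a₂ a₃))
  have hPD : prob p (PDEvent ends a₁ a₂ a₃) = 0 :=
    prob_eq_zero_of_subset_Q hp hQ (PD_subset_Q a₁ a₂ a₃)
  have hTi : ∀ X : Set (Config E), prob p (TEvent ends a₁ a₂ a₃ ∩ X) = 0 := fun X =>
    prob_eq_zero_of_subset_Q hp hQ (Set.inter_subset_left.trans (T_subset_Q a₁ a₂ a₃))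
  have hT : prob p (TEvent ends a₁ a₂ a₃) = 0 :=
    prob_eq_zero_of_subset_Q hp hQ (T_subset_Q a₁ a₂ a₃)
  have hT'i : ∀ X : Set (Config E), prob p (TEvent ends a₂ a₁ a₃ ∩ X) = 0 := fun X =>
    prob_eq_zero_of_subset_Q hp hQ (Set.inter_subset_left.trans (T'_subset_Q a₁ a₂ a₃))
  have hT' : prob p (TEvent ends a₂ a₁ a₃) = 0 :=
    prob_eq_zero_of_subset_Q hp hQ (T'_subset_Q a₁ a₂ a₃)
  unfold Gc DEF EQbo EQb3 EQb3o EQo EQ3 EQ3o PDb PDbo Do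
  rw [gap_eq_Q]
  simp only [hQ, hQi, hPDi, hPD, hTi, hT, hT'i, hT']
  ring

/-- (HCOV) when `Q` is null. -/
theorem HCov_of_Q_eq_zero (hp : IsProbVec p) {o a₁ a₂ a₃ b : V}
    (hQ : prob p (avoidAll ends a₂ {a₁}) = 0) : HCov p ends o a₁ a₂ a₃ b := by
  unfold HCov
  rw [Gc_eq_zero_of_Q_eq_zero hp hQ]

end QNull

/-! ## `P(PD_u) = 0` puts `u` into a root's reach -/

section PinnedWitness

variable {V : Type*} {E : Type*} [Fintype E] [DecidableEq E] {R : Type*} [Field R]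
  [LinearOrder R] [IsStrictOrderedRing R]

variable {p : E → R} {ends : E → Sym2 V}

/-- The probability of an event is at least the weight of any of its configurations. -/
lemma weight_le_prob (hp : IsProbVec p) {S : Set (Config E)} {ω : Config E} (hω : ω ∈ S) :
    weight p ω ≤ prob p S := by
  unfold prob
  have h : S.indicator (weight p) ω = weight p ω := Set.indicator_of_mem hω _
  rw [← h]
  exact Finset.single_le_sum (fun ω' _ => Set.indicator_nonneg (fun ω'' _ => weight_nonneg hp ω'') ω')
    (Finset.mem_univ ω)

omit [DecidableEq E] in
/-- The pinned configuration has positive weight. -/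
lemma weight_pinnedConfig_pos (hp : IsProbVec p) : 0 < weight p (pinnedConfig p) := by
  unfold weight
  refine Finset.prod_pos fun e _ => ?_
  unfold pinnedConfig edgeFactor
  by_cases h : p e = 1
  · simp [h]
  · have h1 : p e < 1 := lt_of_le_of_ne (hp.le_one e) h
    simp only [h, decide_false, Bool.false_eq_true, if_false]
    linarith

omit [LinearOrder R] [IsStrictOrderedRing R] in
/-- A non-null event contains a configuration of nonzero weight. -/
lemma exists_weight_ne_zero_of_prob_ne_zero {S : Set (Config E)} (hS : prob p S ≠ 0) :
    ∃ ω ∈ S, weight p ω ≠ 0 := by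
  unfold prob at hS
  obtain ⟨ω, -, hω⟩ := Finset.exists_ne_zero_of_sum_ne_zero hS
  by_cases hmem : ω ∈ S
  · exact ⟨ω, hmem, by simpa [Set.indicator_of_mem hmem] using hω⟩
  · exact absurd (Set.indicator_of_notMem hmem _) hω

/-- **`P(PD_u) = 0` with `Q` non-null puts `u` into the pinned-open reach of a root**: the pinned
configuration has positive weight and lies in `Q`, so `u ∉ U` there would make `PD_u` non-null. -/
theorem mem_reach_of_prob_PD_eq_zero (hp : IsProbVec p) {a₁ a₂ u : V}
    (hQ : prob p (avoidAll ends a₂ {a₁}) ≠ 0) (hD : prob p (PDEvent ends a₁ a₂ u) = 0) :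
    u ∈ pinnedReach p ends a₁ ∨ u ∈ pinnedReach p ends a₂ := by
  by_contra hnot
  simp only [not_or] at hnot
  obtain ⟨ω, hωQ, hω⟩ := exists_weight_ne_zero_of_prob_ne_zero hQ
  have hle : pinnedConfig p ≤ ω := pinnedConfig_le_of_weight_ne_zero hω
  -- the pinned configuration lies in `PD_u`
  have hmem : pinnedConfig p ∈ PDEvent ends a₁ a₂ u := by
    refine ⟨fun h12 => ?_, fun hU => ?_⟩
    · exact hωQ a₁ (Finset.mem_singleton_self a₁) (conn_symm (conn_mono hle h12))
    · rcases hU with h | h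
      · exact hnot.1 (conn_symm h)
      · exact hnot.2 (conn_symm h)
  have := weight_le_prob hp hmem
  rw [hD] at this
  exact absurd (lt_of_lt_of_le (weight_pinnedConfig_pos hp) this) (lt_irrefl 0)

end PinnedWitness

/-! ## The pendant face from `HCovPlus_all` -/

section Pendant

variable {V E : Type} [Fintype V] [DecidableEq V] [Fintype E] [DecidableEq E]
  {R : Type*} [Field R] [LinearOrder R] [IsStrictOrderedRing R]

/-- A pendant edge of `a₃`: the only fractional edge touching the reach, joining it to an outer vertex. -/
def IsPendantEdge (p : E → R) (ends : E → Sym2 V) (a₃ : V) (f : E) : Prop :=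
  (∀ e ∈ fracEdges p, TouchesReach p ends a₃ e → e = f) ∧
    ∃ z u, ends f = s(z, u) ∧ z ∈ pinnedReach p ends a₃ ∧ u ∉ pinnedReach p ends a₃

/-- **Every pendant edge of a mark-free instance with non-null `Q` is good**, given `HCovPlus_all`
and (HCOV) at its open pin: by (HCOV⁺) at the identified instance (the hypothesis for an unmarked
`u`, the diagonal theorems for `u = o` or `u = b`), or as a reach-root edge (`u` a root, or
`P(PD_u) = 0`). -/
theorem goodEdgeSub_of_pendant (hall : HCovPlus_all R) {p : E → R} (hp : IsProbVec p)
    {ends : E → Sym2 V} {o a₁ a₂ a₃ b : V} {f : E}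
    (h1 : a₁ ≠ a₂) (h2 : a₁ ≠ a₃) (h3 : a₂ ≠ a₃) (h4 : o ≠ a₁) (h5 : o ≠ a₂) (h6 : o ≠ a₃)
    (h7 : o ≠ b) (h8 : b ≠ a₁) (h9 : b ≠ a₂) (h10 : b ≠ a₃)
    (hfree : MarkFree p ends o a₁ a₂ a₃ b) (hpend : IsPendantEdge p ends a₃ f) (hf1 : p f ≠ 1)
    (hQ : prob p (avoidAll ends a₂ {a₁}) ≠ 0)
    (hopen : HCov (Function.update p f 1) ends o a₁ a₂ a₃ b) :
    GoodEdgeSub p ends o a₁ a₂ a₃ b f := by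
  obtain ⟨hK, z, u, hf, hz, hu⟩ := hpend
  have hQpos : 0 < prob p (avoidAll ends a₂ {a₁}) :=
    lt_of_le_of_ne (prob_nonneg hp _) (Ne.symm hQ)
  by_cases hD : prob p (PDEvent ends a₁ a₂ u) = 0
  · -- `u` lies in a root's reach: a reach-root edge
    exact Or.inl (Or.inl ⟨z, hz, u, mem_reach_of_prob_PD_eq_zero hp hQ hD, Or.inr hf⟩)
  by_cases hu1 : u = a₁
  · subst hu1
    exact Or.inl (Or.inl ⟨z, hz, u, Or.inl self_mem_pinnedReach, Or.inr hf⟩)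
  by_cases hu2 : u = a₂
  · subst hu2
    exact Or.inl (Or.inl ⟨z, hz, u, Or.inr self_mem_pinnedReach, Or.inr hf⟩)
  have hDpos : 0 < prob p (PDEvent ends a₁ a₂ u) := lt_of_le_of_ne (prob_nonneg hp _) (Ne.symm hD)
  -- (HCOV⁺) at the identified instance
  have hplus : HCovPlus p ends o a₁ a₂ u b := by
    by_cases huo : u = o
    · subst huo; exact hcovPlus_diag_o p hp a₁ a₂ u b
    by_cases hub : u = b
    · subst hub; exact hcovPlus_diag_b p hp o a₁ a₂ u
    exact hall V E ends p hp o a₁ a₂ u b h1 (Ne.symm hu1) (Ne.symm hu2) h4 h5 (Ne.symm huo) h7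
      h8 h9 (Ne.symm hub)
  obtain ⟨hQ0, hD0, -⟩ := pins_zero_cluster p hK hf hz hu hf1 hfree.1 hfree.2.1 hfree.2.2.1
    hfree.2.2.2
  exact Or.inr ⟨⟨by rw [hQ0]; exact hQpos, by rw [hD0]; exact hQpos⟩,
    sub_of_pendant_of_hcovPlus hK hf hz hu hf1 hfree.1 hfree.2.1 hfree.2.2.1 hfree.2.2.2 hDpos
      hQpos hopen hplus⟩

end Pendant

/-! ## The induction with the pendant face taken by (HCOV⁺) -/

section Induction

variable {V E : Type} [Fintype V] [DecidableEq V] [Fintype E] [DecidableEq E]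
  {R : Type*} [Field R] [LinearOrder R] [IsStrictOrderedRing R]

/-- **(HCOV) from `HCovPlus_all` and a good edge at every mark-free NON-pendant instance with
non-null `Q`.** -/
theorem HCov_of_hcovPlus_all_of_subNP (hall : HCovPlus_all R) (ends : E → Sym2 V) (o a₁ a₂ a₃ b : V)
    (h1 : a₁ ≠ a₂) (h2 : a₁ ≠ a₃) (h3 : a₂ ≠ a₃) (h4 : o ≠ a₁) (h5 : o ≠ a₂) (h6 : o ≠ a₃)
    (h7 : o ≠ b) (h8 : b ≠ a₁) (h9 : b ≠ a₂) (h10 : b ≠ a₃)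
    (hB : ∀ q : E → R, IsProbVec q → MarkFree q ends o a₁ a₂ a₃ b →
      prob q (avoidAll ends a₂ {a₁}) ≠ 0 → (∃ e ∈ fracEdges q, TouchesReach q ends a₃ e) →
      (¬ ∃ f, IsPendantEdge q ends a₃ f) →
      ∃ e ∈ fracEdges q, TouchesReach q ends a₃ e ∧ GoodEdgeSub q ends o a₁ a₂ a₃ b e)
    (p : E → R) (hp : IsProbVec p) : HCov p ends o a₁ a₂ a₃ b := by
  generalize hn : (fracEdges p).card = n
  induction n using Nat.strong_induction_on generalizing p with
  | _ n ih =>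
    by_cases hm : a₁ ∈ pinnedReach p ends a₃ ∨ a₂ ∈ pinnedReach p ends a₃ ∨
        o ∈ pinnedReach p ends a₃ ∨ b ∈ pinnedReach p ends a₃
    · exact HCov_of_mark_mem_pinnedReach hp hm
    · have hfree : MarkFree p ends o a₁ a₂ a₃ b := by
        simp only [not_or] at hm
        exact ⟨hm.1, hm.2.1, hm.2.2.1, hm.2.2.2⟩
      by_cases hQ : prob p (avoidAll ends a₂ {a₁}) = 0
      · exact HCov_of_Q_eq_zero hp hQ
      by_cases h : ∃ e ∈ fracEdges p, TouchesReach p ends a₃ e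
      · -- a good edge: from the hypothesis, or the pendant edge via (HCOV⁺)
        have hgoodex : ∃ e ∈ fracEdges p, TouchesReach p ends a₃ e ∧
            GoodEdgeSub p ends o a₁ a₂ a₃ b e := by
          by_cases hpend : ∃ f, IsPendantEdge p ends a₃ f
          · obtain ⟨f, hf⟩ := hpend
            obtain ⟨e, he, ht⟩ := h
            have hef : e = f := hf.1 e he ht
            subst hef
            have hfe : p e ≠ 0 ∧ p e ≠ 1 := by simpa [fracEdges] using he
            have hlt : ((fracEdges p).erase e).card < n := by
              rw [← hn]; exact Finset.card_erase_lt_of_mem he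
            have hp₁ : IsProbVec (Function.update p e 1) := hp.update e zero_le_one le_rfl
            have hopen : HCov (Function.update p e 1) ends o a₁ a₂ a₃ b :=
              ih _ hlt (Function.update p e 1) hp₁ (by rw [fracEdges_update p e 1 (Or.inr rfl)])
            exact ⟨e, he, ht, goodEdgeSub_of_pendant hall hp h1 h2 h3 h4 h5 h6 h7 h8 h9 h10 hfree hf
              hfe.2 hQ hopen⟩
          · exact hB p hp hfree hQ h hpend
        obtain ⟨e, he, _, hgood⟩ := hgoodex
        have hlt : ((fracEdges p).erase e).card < n := by
          rw [← hn]; exact Finset.card_erase_lt_of_mem he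
        have hp₀ : IsProbVec (Function.update p e 0) := hp.update e le_rfl zero_le_one
        have hp₁ : IsProbVec (Function.update p e 1) := hp.update e zero_le_one le_rfl
        have h₀ : HCov (Function.update p e 0) ends o a₁ a₂ a₃ b :=
          ih _ hlt (Function.update p e 0) hp₀ (by rw [fracEdges_update p e 0 (Or.inl rfl)])
        have h₁ : HCov (Function.update p e 1) ends o a₁ a₂ a₃ b :=
          ih _ hlt (Function.update p e 1) hp₁ (by rw [fracEdges_update p e 1 (Or.inr rfl)])
        have hfe : p e ≠ 0 ∧ p e ≠ 1 := by simpa [fracEdges] using he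
        rcases hgood with (hr | hpa | ⟨hB1, hB2⟩) | ⟨hpos, hs1, hs2⟩
        · obtain ⟨hB1, hB2⟩ := bern_nonneg_of_isReachRootEdge p hp ends o a₁ a₂ a₃ b e hr hfe.2 h₀
          exact HCov_of_update_zero_of_bern p hp ends o a₁ a₂ a₃ b e h₀ h₁ hB1 hB2
        · obtain ⟨hK, z, u, hends, hz, hu, hD, hcov⟩ := hpa
          exact HCov_cluster_of_cov_nonneg p hp hK hends hz hu hfe.2 hfree.1 hfree.2.1
            hfree.2.2.1 hfree.2.2.2 hD h₀ h₁ hcov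
        · exact HCov_of_update_zero_of_bern p hp ends o a₁ a₂ a₃ b e h₀ h₁ hB1 hB2
        · exact HCov_of_update_zero_of_sub p hp ends o a₁ a₂ a₃ b e hpos h₀ h₁ hs1 hs2
      · simp only [not_exists, not_and] at h
        exact HCov_of_reach_pinned p hp ends o a₁ a₂ a₃ b h

end Induction

section Closure

variable (R : Type*) [Field R] [LinearOrder R] [IsStrictOrderedRing R]

/-- **(SUB) at one `a₃`-edge of every mark-free, non-null, NON-pendant instance** (reach-root and
pendant-PA edges free; the pendant instances are not asked). -/
def CPolarA3SubNP_all : Prop :=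
  ∀ (V E : Type) [Fintype V] [DecidableEq V] [Fintype E] [DecidableEq E]
    (ends : E → Sym2 V) (p : E → R), IsProbVec p →
    ∀ o a₁ a₂ a₃ b : V, a₁ ≠ a₂ → a₁ ≠ a₃ → a₂ ≠ a₃ → o ≠ a₁ → o ≠ a₂ → o ≠ a₃ → o ≠ b →
      b ≠ a₁ → b ≠ a₂ → b ≠ a₃ → MarkFree p ends o a₁ a₂ a₃ b →
      prob p (avoidAll ends a₂ {a₁}) ≠ 0 → (∃ e ∈ fracEdges p, TouchesReach p ends a₃ e) →
      (¬ ∃ f, IsPendantEdge p ends a₃ f) →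
      ∃ e ∈ fracEdges p, TouchesReach p ends a₃ e ∧ GoodEdgeSub p ends o a₁ a₂ a₃ b e

omit [IsStrictOrderedRing R] in
/-- `CPolarA3SubNP_all` is weaker than `CPolarA3Sub_all`. -/
theorem cpolarA3SubNP_all_of_cpolarA3Sub_all (h : CPolarA3Sub_all R) : CPolarA3SubNP_all R :=
  fun V E _ _ _ _ ends p hp o a₁ a₂ a₃ b h1 h2 h3 h4 h5 h6 h7 h8 h9 h10 hfree _ hex _ =>
    h V E ends p hp o a₁ a₂ a₃ b h1 h2 h3 h4 h5 h6 h7 h8 h9 h10 hfree hex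

/-- **The crux from `HCovPlus_all` and (SUB) at the non-pendant instances.** -/
theorem HCov_all_of_cpolarA3SubNP_all (hall : HCovPlus_all R) (h : CPolarA3SubNP_all R) :
    HCov_all R := by
  intro V E _ _ _ _ ends p hp o a₁ a₂ a₃ b h1 h2 h3 h4 h5 h6 h7 h8 h9 h10
  exact HCov_of_hcovPlus_all_of_subNP hall ends o a₁ a₂ a₃ b h1 h2 h3 h4 h5 h6 h7 h8 h9 h10
    (fun q hq hfree hQ hex hnp =>
      h V E ends q hq o a₁ a₂ a₃ b h1 h2 h3 h4 h5 h6 h7 h8 h9 h10 hfree hQ hex hnp) p hp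

end Closure

end CPolarSubNP

end Summit.Ventures.PercRepro2
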